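/-
COR-CM (cell pub-hodgecm2, stage 2 of the Hodge ladder) — count-neutral own lane FOREIGN-SURFACE (seat prover-pub-hodgecm2-p2,
binder prover 2, gen 23; claim in HOME/lit/LIT-STATUS.md + LIT-CLAIMS.md, path named in HOME/INBOX.md before filing).  Theorems
only; no definition, no named fact, nothing asserted.  Composition BY NAME of tree theorems: the field-agnostic surface criterion
`Universe.weilLine_quad_le_alg_of_periodNV` (`CorCM/SurfaceCriterionQuadruple.lean`, this seat gen 22), the chain assembly
`Assembly.hc_cm_of` / `Model.hc_cm_of_rows` (`CorCM/Assembly/*`, `CorCM/FacePeriodWitnesses.lean`, b07) and the face-line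
currency consumers of b24/b23 (`CorCM/Model/CMSliceOfWeilFaces.lean`, `CorCM/FacePeriodsFieldLocal.lean`); nothing of theirs is
restated.  NOT an E term, NOT a display of record, no BINDER-OWNERS row; `Interfaces.lean` (C1) and `Assembly/ModelChain*.lean`
untouched.

HONEST FRAMING (COORDINATOR RULING — HODGE FRAMING CORRECTION, 2026-08-21T11:55:35Z): `HC_CM` (the Hodge conjecture for ALL
complex abelian varieties of CM type) is NOT proved, here or anywhere in the tree.  This file proves NO face period.  It records that
two of the five «deltas» by which `PerLFace` exceeds `PerL` (hodge-director/B01-SIZE.md §1: Δ4 «every ADMISSIBLE base place ι₁»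
and Δ5 «surface field = CM field of the targets») are NOT needed by the chain: the weakest period statement from which the landed
chain closes `HC_CM` quantifies, per Galois CM field `F` of degree `≥ 6` and per face `f` of `F`, over ONE compact Picard modular
surface of ANY CM field `L`, at ANY complex place `ι₁` of `L`, on ANY hermitian 3-space over `(L, ι₁)`, with eigenforms at ANY
embedding `σ` of `F`.
-/
import Summits.HodgeConjecture.CorCM.FacePeriodsFieldLocal
import Summits.HodgeConjecture.CorCM.SurfaceCriterionQuadruple
import HarnessLib

/-!
# Face periods on Picard modular surfaces of a FOREIGN CM field ⟹ `HC_CM` (the chain without Δ4 and Δ5)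

The cell's closed witness form of the chain, `hc_cm_closed_of_exists_facePeriod` (`CorCM/FacePeriodWitnesses.lean` :189), reads

  (∀ Galois CM `F`, `6 ≤ [F:ℚ]`, ∀ face `f` of `F`, ∃ ι₁ ADMISSIBLE for `f`, ∃ `V : HermSpace3 F ι₁`, ∃ `σ`,
      `U_rec.PeriodNV ι₁ V F f.psi σ`) ⟹ `HC_CM`,

and `hodge-director/CHAIN-WEAKENING.md` §1 (3)–(4) records the residue of binder B01 accordingly as «all degrees `2g ≥ 6` × all faces ×
(surface field = CM field of the corners), one good `(ι₁, V, σ, Γ)` each».  Its first arrow goes through the surface criterion typed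
over faces (`Universe.SurfaceCriterion`, `CorCM/Geometry/Statements.lean` :95: the surface is `P_Γ(V)` for a hermitian space over THE
SAME field `F` at an ADMISSIBLE place, eigenforms transported to `ι₁` by `Fact_eigenLine`/`Fact_alphaLine`).

The surface criterion itself needs none of this.  Steps A–D of rfwf Prop. 2.2 were re-typed over an arbitrary quadruple
`(K, Ψ, σ)` and an arbitrary surface in `CorCM/SurfaceCriterionQuadruple.lean` (`Universe.weilLine_quad_le_alg_of_period`), and its
Picard-modular packaging `Universe.weilLine_quad_le_alg_of_periodNV` takes `U.PeriodNV ι₁ V K Ψ σ` with `V : HermSpace3 L ι₁` over ANY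
CM field `L` and ANY `ι₁ : L →+* ℂ` — exactly the shape in which stage 1's `PerL` produces its witnesses (`K` sextic, `L` its normal
closure of degree 24/48).  Feeding that atom into the landed assembly gives, with no new mathematics:

* §1 (abstract universe, `M : U.ModelAxioms`) `Universe.weilFaceAlgebraic_of_foreignPeriodNV`: ONE non-zero period of the face
  quadruple `f.psi` of ANY CM field `F` (no Galois hypothesis, no degree hypothesis) on ONE compact Picard modular surface
  `P_Γ(V)`, `V` hermitian over ANY CM field `L` at ANY place `ι₁`, eigenforms at ANY `σ : F →+* ℂ` ⟹ `U.WeilFaceAlgebraic F f`;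
  hence `Universe.w_rk4_of_exists_foreignPeriodNV` and the field-local `Universe.hc_cmProd_of_exists_foreignPeriodNV_at`;
  `Assembly.hc_cm_of_exists_foreignPeriodNV` (the pattern of `Assembly.hc_cm_of_exists_periodNV` with the weaker hypothesis).
* §2 (model rows, modulo Riemann's theorem `hR`) and §3 (CLOSED, universe of record at the tree theorems):
  **`hc_cm_closed_of_exists_foreignFacePeriod`** —

    (∀ Galois CM `F`, `6 ≤ [F:ℚ]`, ∀ face `f` of `F`, ∃ CM field `L`, ∃ `ι₁ : L →+* ℂ`, ∃ `V : HermSpace3 L ι₁`, ∃ `σ : F →+* ℂ`,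
        `U_rec.PeriodNV ι₁ V F f.psi σ`) ⟹ `HC_CM`.

  The old hypothesis implies the new one with `L := F` (`exists_foreignFacePeriod_of_exists_facePeriod`), so display F3
  `hc_cm_closed_of_perLFace` and b07's witness theorem both factor through this file (`example`s at the end of §3).
* §4 (CLOSED, field-local = b23's INT-2 schema with foreign surfaces): for ONE Galois CM field `K` with `6 ≤ [K:ℚ]`, foreign period
  witnesses for the faces of `K` ⟹ the Hodge conjecture for every complex abelian variety dominated by a product of realisations of
  CM types of CM subfields of `K` (`hodgeConjectureFor_of_avDominatedBy_isProductOf_of_exists_foreignFacePeriod_at`), and the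
  per-face atom `weilFaceAlgebraic_of_exists_foreignFacePeriod` with NO Galois and NO degree hypothesis on the field of the face.

NET (for CHAIN-WEAKENING §1 / B01-SIZE §1): of the five deltas Δ1 (all degrees) Δ2 (all faces) Δ3 (∀V) Δ4 (∀ admissible ι₁)
Δ5 (surface field = CM field), the chain as landed consumes only Δ1 × Δ2 with ONE datum `(L, ι₁, V, Γ, σ)` per face, `L`
unrestricted.  What still separates the SHAPE of `PerL`'s conclusion from an instance of the hypothesis is only that `PerL`'s target
field `K` is a non-Galois sextic field (the chain quantifies over Galois `F`; rfwf Lemma 8.2) — not the foreign surface field.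
Nothing here asserts any period; `HC_CM`, `PerL`, `PerLFace` are neither used as facts nor proved.

## References
* rfwf v3 (2001 programme), Prop. 2.2 (surface criterion), Thm 1.3 (`W^{RK4}`), Lemma 8.2 — primary source
  `pub-hodgecm/inputs/2001/summits__hodge-w-rank-four-weil-faces__free__y1__paper__paper.tex`.
* [Pohlmann1968] H. Pohlmann, Ann. of Math. 88 (1968), Thm. 1.
* [Andre1992HodgeCM] Y. André, Progr. Math. 102 (1992), Théorème pp. 4–5.
* [Milne2020HodgeClassesAV] J. S. Milne, *Hodge classes on abelian varieties* (2020), Theorem 1.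
* [MumfordAV1970] D. Mumford, *Abelian Varieties* (1970), §19 Thm. 1 and p. 169.
* [Shimura1998] G. Shimura, *Abelian Varieties with Complex Multiplication and Modular Functions* (1998), §6.1–6.2.
* [DeligneMilne1982Tannakian] P. Deligne, J. S. Milne, LNM 900 (1982), Thm. 6.20.
-/

noncomputable section

open CategoryTheory NumberField
open Literature.AlgebraicGeometry Literature.AlgebraicGeometry.Motives Literature.AlgebraicGeometry.HodgeTheory
open Literature.AlgebraicGeometry.ComplexMultiplication Literature.AlgebraicGeometry.Milne1999
open Literature.NumberTheory.Automorphic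
open Literature.NumberTheory.Automorphic.PicardCM

namespace Summit.HodgeConjecture.CorCM

/-! ## §1 Abstract universe with the model facts -/

namespace Universe

variable {U : Universe}

/-- **FACE-LOCAL ATOM, foreign surface field.**  On a universe with the model facts (`M : U.ModelAxioms`): for ANY CM field `F`
(no Galois hypothesis, no degree hypothesis) and any face `f` of `F`, ONE non-zero period of the face quadruple `f.psi` on ONE compact
Picard modular surface `P_Γ(V)` — `V` a hermitian 3-space over ANY CM field `L` at ANY place `ι₁ : L →+* ℂ`, holomorphic eigenforms at
ANY embedding `σ : F →+* ℂ` — makes the Weil line `W_F(P(f)) ⊂ H⁴(∏_{i<4} A_{(F, f.corner i)}, ℚ)` algebraic.  (Steps A–D of rfwf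
Prop. 2.2 over the corner quadruple, `weilLine_quad_le_alg_of_periodNV`, and `Face.corner_eq_quad`.)
[cite: Pohlmann1968, Thm. 1] -/
theorem weilFaceAlgebraic_of_foreignPeriodNV (M : U.ModelAxioms) {F : CMField} (f : Face F) {L : CMField}
    {ι₁ : L →+* ℂ} {V : HermSpace3 L ι₁} {σ : F →+* ℂ} (h : U.PeriodNV ι₁ V F f.psi σ) :
    U.WeilFaceAlgebraic F f := by
  unfold WeilFaceAlgebraic
  rw [Face.corner_eq_quad]
  exact weilLine_quad_le_alg_of_periodNV M h

/-- Existential packaging of the foreign atom: SOME CM field `L`, SOME place `ι₁`, SOME hermitian 3-space, SOME eigen-embedding `σ`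
(and, inside `PeriodNV`, SOME level with a non-zero period) ⟹ `U.WeilFaceAlgebraic F f`.  [cite: Pohlmann1968, Thm. 1] -/
theorem weilFaceAlgebraic_of_exists_foreignPeriodNV (M : U.ModelAxioms) {F : CMField} (f : Face F)
    (h : ∃ (L : CMField) (ι₁ : L →+* ℂ) (V : HermSpace3 L ι₁) (σ : F →+* ℂ), U.PeriodNV ι₁ V F f.psi σ) :
    U.WeilFaceAlgebraic F f := by
  obtain ⟨L, ι₁, V, σ, h⟩ := h
  exact weilFaceAlgebraic_of_foreignPeriodNV M f h

/-- The same-field, admissible-place witness of `Universe.w_rk4_of_exists_periodNV` IS a foreign witness (`L := F`): the hypothesis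
of this file is implied by the cell's witness hypothesis of record (so it is weaker or equal). [folklore] -/
theorem exists_foreignPeriodNV_of_exists_periodNV {F : CMField} (f : Face F)
    (h : ∃ ι₁ : F →+* ℂ, f.Admissible ι₁ ∧ ∃ (V : HermSpace3 F ι₁) (σ : F →+* ℂ), U.PeriodNV ι₁ V F f.psi σ) :
    ∃ (L : CMField) (ι₁ : L →+* ℂ) (V : HermSpace3 L ι₁) (σ : F →+* ℂ), U.PeriodNV ι₁ V F f.psi σ := by
  obtain ⟨ι₁, -, V, σ, h⟩ := h
  exact ⟨F, ι₁, V, σ, h⟩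

/-- `PeriodThmF` (`PerLFace`) gives a foreign witness for every face of every Galois CM field of degree `≥ 6` (through the same-field
witness, `facePeriodWitness_of_periodThmF`). [folklore] -/
theorem foreignFacePeriodWitness_of_periodThmF (h : U.PeriodThmF) :
    ∀ (F : CMField), IsGalois ℚ F → 6 ≤ Module.finrank ℚ F → ∀ f : Face F,
      ∃ (L : CMField) (ι₁ : L →+* ℂ) (V : HermSpace3 L ι₁) (σ : F →+* ℂ), U.PeriodNV ι₁ V F f.psi σ :=
  fun F hG h6 f => exists_foreignPeriodNV_of_exists_periodNV f (facePeriodWitness_of_periodThmF h F hG h6 f)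

/-- **Foreign face-period witnesses give `W^{RK4}`** (the pattern of `Universe.w_rk4_of_exists_periodNV`, WITHOUT the eigenline
transport and WITHOUT the admissibility of the base place): if every face of every Galois CM field of degree `≥ 6` has a non-zero
period on some compact Picard modular surface of some CM field, every rank-four Weil line is algebraic. [cite: Pohlmann1968, Thm. 1] -/
theorem w_rk4_of_exists_foreignPeriodNV (M : U.ModelAxioms)
    (h : ∀ (F : CMField), IsGalois ℚ F → 6 ≤ Module.finrank ℚ F → ∀ f : Face F,
      ∃ (L : CMField) (ι₁ : L →+* ℂ) (V : HermSpace3 L ι₁) (σ : F →+* ℂ), U.PeriodNV ι₁ V F f.psi σ) :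
    U.W_RK4 :=
  fun F hG h6 f => weilFaceAlgebraic_of_exists_foreignPeriodNV M f (h F hG h6 f)

/-- **FIELD-LOCAL SCHEMA, foreign surfaces (abstract).**  With `FaceReduction` (Pohlmann + [QW8] Thm 2.5): for ONE Galois CM field
`F` with `6 ≤ [F:ℚ]`, one foreign period witness per face of `F` implies `U.HC (∏_j A_{(F,Θ_j)})` in every codimension, for every
finite family `Θ` of CM types of `F`. [cite: Pohlmann1968, Thm. 1] [cite: Andre1992HodgeCM, Théorème (pp. 4–5)] -/
theorem hc_cmProd_of_exists_foreignPeriodNV_at (M : U.ModelAxioms) (hFR : U.FaceReduction) {F : CMField}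
    (hG : IsGalois ℚ F) (h6 : 6 ≤ Module.finrank ℚ F)
    (h : ∀ f : Face F, ∃ (L : CMField) (ι₁ : L →+* ℂ) (V : HermSpace3 L ι₁) (σ : F →+* ℂ), U.PeriodNV ι₁ V F f.psi σ)
    {n : ℕ} (Θ : Fin (n + 1) → CMType F) : U.HC (U.cmProd F Θ) :=
  hFR F hG h6 (fun f => weilFaceAlgebraic_of_exists_foreignPeriodNV M f (h f)) n Θ

end Universe

namespace Assembly

open Universe StubTree

variable (U : Universe)

/-- **COR-CM from foreign face-period witnesses** — `Assembly.hc_cm_of_exists_periodNV` with the weaker hypothesis: for a universe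
satisfying the 28 model facts `ModelAxioms` and the textbook facts N1–N4, F2, F4–F7, one non-zero face period per face of every Galois
CM field of degree `≥ 6`, each on some compact Picard modular surface of SOME CM field (any place, any hermitian 3-space, any level,
any eigen-embedding), implies `U.HC_CM`: witnesses ⟹ (field-agnostic surface criterion) `W^{RK4}` ⟹ (Pohlmann + [QW8] Thm 2.5)
`FaceReduction` ⟹ (rfwf Lemma 8.2) `HC_CM`. [cite: Pohlmann1968, Thm. 1] [cite: Andre1992HodgeCM, Théorème (pp. 4–5)]
[cite: Milne2020HodgeClassesAV, Theorem 1] -/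
theorem hc_cm_of_exists_foreignPeriodNV (M : U.ModelAxioms)
    (h : ∀ (F : CMField), IsGalois ℚ F → 6 ≤ Module.finrank ℚ F → ∀ f : Face F,
      ∃ (L : CMField) (ι₁ : L →+* ℂ) (V : HermSpace3 L ι₁) (σ : F →+* ℂ), U.PeriodNV ι₁ V F f.psi σ)
    (hN1 : U.Fact_cupExterior) (hN2 : U.Fact_cup_hodge) (hN3 : U.Fact_pull_H0) (hN4 : U.Fact_hodge_F0)
    (h2 : U.Fact_factorActDescends) (h4 : U.Fact_cupAlg) (h5 : U.Fact_cupAssoc) (h6 : U.Fact_weightDual)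
    (h7 : U.Fact_gysin) : U.HC_CM :=
  hc_cm_of U (Universe.w_rk4_of_exists_foreignPeriodNV M h)
    (faceReduction_holds U (U.pohlmannSpan_of_facts M hN1 hN2 hN3 hN4)
      (U.qw8Sufficiency_of_geometricFacts M hN1 hN2 hN3 hN4 h2 h4 h5 h6 h7))
    (lemma81_holds U M)

end Assembly

/-! ## §2 The model universe, modulo Riemann's theorem -/

namespace Model

open Summit.HodgeConjecture.CorCM.Domination

/-- **One face, foreign surface, on the model** (`ModelAxioms` of `universeOf hHD hI hU h₃` assembled modulo Riemann's theorem `hR`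
as in `Model.hc_cm_of_rows`): a foreign period witness for the face `f` of ANY CM field `F` makes `W_F(P(f))` algebraic on
`Model.universeOf hHD hI hU h₃`.  No Galois hypothesis, no degree hypothesis, no admissibility.
[cite: DeligneMilne1982Tannakian, §6 Thm. 6.20 (Riemann), p. 212] [cite: Pohlmann1968, Thm. 1] -/
theorem universeOf_weilFaceAlgebraic_of_exists_foreignPeriodNV
    (hHD : exists_isReal_hodgeModel) (hI : hodgePQ_independent_of_hodgeModel) (hU : BallQuotientUniformisedDatum)
    (h₃ : CMAbelianVarietyRealised) (hR : DeligneMilne1982_Thm_6_20_full) {F : CMField} (f : Face F)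
    (h : ∃ (L : CMField) (ι₁ : L →+* ℂ) (V : HermSpace3 L ι₁) (σ : F →+* ℂ),
      (universeOf hHD hI hU h₃).PeriodNV ι₁ V F f.psi σ) :
    (universeOf hHD hI hU h₃).WeilFaceAlgebraic F f :=
  Universe.weilFaceAlgebraic_of_exists_foreignPeriodNV
    (modelAxioms_of_rows hHD hI hU h₃ hR (universeOf_algDuality hHD hI hU h₃)) f h

/-- **The model chain from foreign witnesses, rows M22 and F7 as hypotheses** (the pattern of
`Model.hc_cm_of_rows_of_exists_periodNV`). [cite: DeligneMilne1982Tannakian, §6 Thm. 6.20 (Riemann), p. 212]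
[cite: Andre1992HodgeCM, Théorème (pp. 4–5)] -/
theorem hc_cm_of_rows_of_exists_foreignPeriodNV (hHD : exists_isReal_hodgeModel)
    (hI : hodgePQ_independent_of_hodgeModel) (hU : BallQuotientUniformisedDatum) (h₃ : CMAbelianVarietyRealised)
    (hR : DeligneMilne1982_Thm_6_20_full) (h28 : (universeOf hHD hI hU h₃).Fact_algDuality)
    (hF7 : (universeOf hHD hI hU h₃).Fact_gysin)
    (h : ∀ (F : CMField), IsGalois ℚ F → 6 ≤ Module.finrank ℚ F → ∀ f : Face F,
      ∃ (L : CMField) (ι₁ : L →+* ℂ) (V : HermSpace3 L ι₁) (σ : F →+* ℂ),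
        (universeOf hHD hI hU h₃).PeriodNV ι₁ V F f.psi σ) :
    (universeOf hHD hI hU h₃).HC_CM :=
  Assembly.hc_cm_of_exists_foreignPeriodNV (universeOf hHD hI hU h₃) (modelAxioms_of_rows hHD hI hU h₃ hR h28) h
    (universeOf_fact_cupExterior hHD hI hU h₃) (universeOf_fact_cup_hodge hHD hI hU h₃)
    (universeOf_fact_pull_H0 hHD hI hU h₃) (universeOf_fact_hodge_F0 hHD hI hU h₃)
    (universeOf_fact_factorActDescends hHD hI hU h₃ (modelAxioms_of_rows hHD hI hU h₃ hR h28))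
    (universeOf_fact_cupAlg hHD hI hU h₃) (universeOf_fact_cupAssoc hHD hI hU h₃)
    (universeOf_fact_weightDual hHD hI hU h₃ (modelAxioms_of_rows hHD hI hU h₃ hR h28)) hF7

/-- **The model chain from foreign witnesses, CLOSED rows** (M22 = `universeOf_algDuality`, F7 = `universeOf_fact_gysin`; the
pattern of `Model.chainR_of_exists_periodNV`): for every instance of the universe of record, Riemann's theorem and one foreign
face-period witness per face imply `U.HC_CM`. [cite: DeligneMilne1982Tannakian, §6 Thm. 6.20 (Riemann), p. 212]
[cite: Milne2020HodgeClassesAV, Theorem 1] -/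
theorem chainR_of_exists_foreignPeriodNV (hHD : exists_isReal_hodgeModel) (hI : hodgePQ_independent_of_hodgeModel)
    (h₁ : BallQuotientUniformised) (h₃ : CMAbelianVarietyRealised) (hR : DeligneMilne1982_Thm_6_20_full)
    (h : ∀ (F : CMField), IsGalois ℚ F → 6 ≤ Module.finrank ℚ F → ∀ f : Face F,
      ∃ (L : CMField) (ι₁ : L →+* ℂ) (V : HermSpace3 L ι₁) (σ : F →+* ℂ),
        (picardCMUniverse hHD hI h₁ h₃).PeriodNV ι₁ V F f.psi σ) :
    (picardCMUniverse hHD hI h₁ h₃).HC_CM :=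
  hc_cm_of_rows_of_exists_foreignPeriodNV hHD hI (ballQuotientUniformisedDatum_of h₁) h₃ hR
    (universeOf_algDuality hHD hI _ h₃) (universeOf_fact_gysin hHD hI _ h₃) h

/-- **The `F`-generated CM slice from foreign witnesses, on the model** (b24's
`hodgeConjectureFor_of_avDominatedBy_isProductOf_of_weilFaceAlgebraic_of_riemann` fed face by face): for ONE Galois CM field `F`
with `6 ≤ [F:ℚ]` and one foreign period witness per face of `F`, every complex abelian variety dominated by a finite product of
realisations of CM types of CM fields embeddable in `F` satisfies the Hodge conjecture in every codimension, modulo `hR`.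
[cite: Shimura1998, §6.2 Theorem 3 and §6.1 Corollary of Theorem 2 (pp. 41–43)] [cite: MumfordAV1970, §19 Thm. 1 and p. 169] -/
theorem hodgeConjectureFor_of_avDominatedBy_isProductOf_of_exists_foreignPeriodNV_at
    (hHD : exists_isReal_hodgeModel) (hI : hodgePQ_independent_of_hodgeModel) (hU : BallQuotientUniformisedDatum)
    (h₃ : CMAbelianVarietyRealised) (hR : DeligneMilne1982_Thm_6_20_full)
    {F : CMField} (hG : IsGalois ℚ F) (h6 : 6 ≤ Module.finrank ℚ F)
    (h : ∀ f : Face F, ∃ (L : CMField) (ι₁ : L →+* ℂ) (V : HermSpace3 L ι₁) (σ : F →+* ℂ),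
      (universeOf hHD hI hU h₃).PeriodNV ι₁ V F f.psi σ)
    {P A : AbelianVariety ℂ} (hP : AbelianVariety.IsProductOf (fun B : AbelianVariety ℂ =>
      ∃ (E : Type) (_ : Field E) (_ : NumberField E) (_ : IsCMField E) (_ : E →+* (F : Type)) (Φ : CMType E)
        (ι : 𝓞 E →+* End B) (θ : E →+* Module.End ℂ (complexBetti B.X 1)),
        IsCMTypeRealisation Φ B ι θ) P)
    (hA : AVDominatedBy A P) : HodgeConjectureFor A.dim A.X :=
  hodgeConjectureFor_of_avDominatedBy_isProductOf_of_weilFaceAlgebraic_of_riemann hHD hI hU h₃ F hR hG h6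
    (fun f => universeOf_weilFaceAlgebraic_of_exists_foreignPeriodNV hHD hI hU h₃ hR f (h f)) hP hA

end Model

/-! ## §3 CLOSED forms on the universe of record: the global chain -/

open Summit.HodgeConjecture.CorCM.Domination

/-- **`HC_CM` from foreign face-period witnesses**, rows form (the pattern of `hc_cm_of_exists_facePeriod`): for every instance
`hHD hI h₁ h₃` of the Picard–CM model universe, one non-zero face period per face of every Galois CM field of degree `≥ 6` — each on a
compact Picard modular surface of SOME CM field, at some place, on some hermitian 3-space, at some level, eigenforms at some embedding
— together with Riemann's theorem implies `HC_CM` (BY NAME). [cite: DeligneMilne1982Tannakian, §6 Thm. 6.20 (Riemann), p. 212]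
[cite: Andre1992HodgeCM, Théorème (pp. 4–5)] [cite: Milne2020HodgeClassesAV, Theorem 1] -/
theorem hc_cm_of_exists_foreignFacePeriod (hHD : exists_isReal_hodgeModel) (hI : hodgePQ_independent_of_hodgeModel)
    (h₁ : BallQuotientUniformised) (h₃ : CMAbelianVarietyRealised)
    (h : ∀ (F : CMField), IsGalois ℚ F → 6 ≤ Module.finrank ℚ F → ∀ f : Face F,
      ∃ (L : CMField) (ι₁ : L →+* ℂ) (V : HermSpace3 L ι₁) (σ : F →+* ℂ),
        (Model.picardCMUniverse hHD hI h₁ h₃).PeriodNV ι₁ V F f.psi σ)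
    (hR : DeligneMilne1982_Thm_6_20_full) : HC_CM :=
  hc_cm_of_model_hc_cm_riemann hHD hI h₁ h₃ hR (Model.chainR_of_exists_foreignPeriodNV hHD hI h₁ h₃ hR h)

/-- **`HC_CM` from foreign face-period witnesses ALONE — the chain without Δ4 and Δ5.**  On the Picard–CM model universe of record
(at the tree theorems `exists_isReal_hodgeModel_holds`, `hodgePQ_independent_of_hodgeModel_holds`,
`BallQuotient.ballQuotientUniformised_holds`, `cmAbelianVarietyRealised_holds`; Riemann's theorem by
`deligneMilne1982_Thm_6_20_full_holds`): if for every Galois CM field `F` with `6 ≤ [F:ℚ]` and every rank-four face `f` of `F` there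
are SOME CM field `L`, SOME place `ι₁ : L →+* ℂ`, SOME hermitian 3-space `V` over `(L, ι₁)`, SOME embedding `σ : F →+* ℂ` and (inside
`PeriodNV`) SOME torsion-free level `Γ` with morphisms `P_Γ(V) → A_{(F, ψ_i(f))}` and `σ`-eigen holomorphic one-forms of non-zero
period, then the Hodge conjecture holds for every complex abelian variety of CM type.  The surface field `L` is unrestricted (it may
differ from `F`, as in stage 1's `PerL`, where the surface lives over the normal closure of the sextic CM field of the targets), and
`ι₁` need not be admissible for `f`.  FRAMING: a conditional; neither side is asserted; `HC_CM` is NOT proved.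
[cite: Pohlmann1968, Thm. 1] [cite: Andre1992HodgeCM, Théorème (pp. 4–5)] [cite: Milne2020HodgeClassesAV, Theorem 1]
[cite: DeligneMilne1982Tannakian, §6 Thm. 6.20 (Riemann), p. 212] -/
theorem hc_cm_closed_of_exists_foreignFacePeriod
    (h : ∀ (F : CMField), IsGalois ℚ F → 6 ≤ Module.finrank ℚ F → ∀ f : Face F,
      ∃ (L : CMField) (ι₁ : L →+* ℂ) (V : HermSpace3 L ι₁) (σ : F →+* ℂ),
        (Model.picardCMUniverse exists_isReal_hodgeModel_holds hodgePQ_independent_of_hodgeModel_holds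
          BallQuotient.ballQuotientUniformised_holds cmAbelianVarietyRealised_holds).PeriodNV ι₁ V F f.psi σ) : HC_CM :=
  hc_cm_of_exists_foreignFacePeriod _ _ _ _ h deligneMilne1982_Thm_6_20_full_holds

/-- The cell's witness hypothesis of record (`hc_cm_closed_of_exists_facePeriod`, same field, admissible place) implies the
hypothesis of `hc_cm_closed_of_exists_foreignFacePeriod` (take `L := F`); so that theorem factors through this file. [folklore] -/
theorem exists_foreignFacePeriod_of_exists_facePeriod
    (h : ∀ (F : CMField), IsGalois ℚ F → 6 ≤ Module.finrank ℚ F → ∀ f : Face F,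
      ∃ ι₁ : F →+* ℂ, f.Admissible ι₁ ∧ ∃ (V : HermSpace3 F ι₁) (σ : F →+* ℂ),
        (Model.picardCMUniverse exists_isReal_hodgeModel_holds hodgePQ_independent_of_hodgeModel_holds
          BallQuotient.ballQuotientUniformised_holds cmAbelianVarietyRealised_holds).PeriodNV ι₁ V F f.psi σ) :
    ∀ (F : CMField), IsGalois ℚ F → 6 ≤ Module.finrank ℚ F → ∀ f : Face F,
      ∃ (L : CMField) (ι₁ : L →+* ℂ) (V : HermSpace3 L ι₁) (σ : F →+* ℂ),
        (Model.picardCMUniverse exists_isReal_hodgeModel_holds hodgePQ_independent_of_hodgeModel_holds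
          BallQuotient.ballQuotientUniformised_holds cmAbelianVarietyRealised_holds).PeriodNV ι₁ V F f.psi σ :=
  fun F hG h6 f => Universe.exists_foreignPeriodNV_of_exists_periodNV f (h F hG h6 f)

/-- `PerLFace` of the universe of record (the hypothesis of display F3 `hc_cm_closed_of_perLFace`) implies the foreign witness
hypothesis; F3 factors through this file as well. [folklore] -/
theorem exists_foreignFacePeriod_of_perLFace
    (hP : (Model.picardCMUniverse exists_isReal_hodgeModel_holds hodgePQ_independent_of_hodgeModel_holds
      BallQuotient.ballQuotientUniformised_holds cmAbelianVarietyRealised_holds).PerLFace) :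
    ∀ (F : CMField), IsGalois ℚ F → 6 ≤ Module.finrank ℚ F → ∀ f : Face F,
      ∃ (L : CMField) (ι₁ : L →+* ℂ) (V : HermSpace3 L ι₁) (σ : F →+* ℂ),
        (Model.picardCMUniverse exists_isReal_hodgeModel_holds hodgePQ_independent_of_hodgeModel_holds
          BallQuotient.ballQuotientUniformised_holds cmAbelianVarietyRealised_holds).PeriodNV ι₁ V F f.psi σ :=
  Universe.foreignFacePeriodWitness_of_periodThmF hP

/- Consistency checks (`example`s, not constants): b07's closed witness theorem and display F3 recovered through the foreign form. -/
example
    (h : ∀ (F : CMField), IsGalois ℚ F → 6 ≤ Module.finrank ℚ F → ∀ f : Face F,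
      ∃ ι₁ : F →+* ℂ, f.Admissible ι₁ ∧ ∃ (V : HermSpace3 F ι₁) (σ : F →+* ℂ),
        (Model.picardCMUniverse exists_isReal_hodgeModel_holds hodgePQ_independent_of_hodgeModel_holds
          BallQuotient.ballQuotientUniformised_holds cmAbelianVarietyRealised_holds).PeriodNV ι₁ V F f.psi σ) : HC_CM :=
  hc_cm_closed_of_exists_foreignFacePeriod (exists_foreignFacePeriod_of_exists_facePeriod h)

example
    (hP : (Model.picardCMUniverse exists_isReal_hodgeModel_holds hodgePQ_independent_of_hodgeModel_holds
      BallQuotient.ballQuotientUniformised_holds cmAbelianVarietyRealised_holds).PerLFace) : HC_CM :=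
  hc_cm_closed_of_exists_foreignFacePeriod (exists_foreignFacePeriod_of_perLFace hP)

/-! ## §4 CLOSED forms on the universe of record: one face, one field -/

/-- **FACE-LOCAL ATOM on the universe of record, foreign surface.**  For ANY CM field `F` (no Galois, no degree hypothesis) and ONE
face `f` of `F`: a foreign period witness on the Picard–CM model universe of record makes the Weil line `W_F(P(f))` algebraic there.
[cite: Pohlmann1968, Thm. 1] [cite: DeligneMilne1982Tannakian, §6 Thm. 6.20 (Riemann), p. 212] -/
theorem weilFaceAlgebraic_of_exists_foreignFacePeriod {F : CMField} (f : Face F)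
    (h : ∃ (L : CMField) (ι₁ : L →+* ℂ) (V : HermSpace3 L ι₁) (σ : F →+* ℂ),
      (Model.picardCMUniverse exists_isReal_hodgeModel_holds hodgePQ_independent_of_hodgeModel_holds
        BallQuotient.ballQuotientUniformised_holds cmAbelianVarietyRealised_holds).PeriodNV ι₁ V F f.psi σ) :
    (Model.picardCMUniverse exists_isReal_hodgeModel_holds hodgePQ_independent_of_hodgeModel_holds
      BallQuotient.ballQuotientUniformised_holds cmAbelianVarietyRealised_holds).WeilFaceAlgebraic F f :=
  Model.universeOf_weilFaceAlgebraic_of_exists_foreignPeriodNV _ _ _ _ deligneMilne1982_Thm_6_20_full_holds f h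

/-- **`HodgeConjectureFor (∏_j A_{(K,Θ_j)})` from the foreign face periods of `K` alone**, for ONE Galois CM field `K` with
`6 ≤ [K:ℚ]`. [cite: Pohlmann1968, Thm. 1] [cite: Andre1992HodgeCM, Théorème (pp. 4–5)] -/
theorem hodgeConjectureFor_cmProdAV_of_exists_foreignFacePeriod_at (K : CMField) [hG : IsGalois ℚ K]
    (h6 : 6 ≤ Module.finrank ℚ K)
    (h : ∀ f : Face K, ∃ (L : CMField) (ι₁ : L →+* ℂ) (V : HermSpace3 L ι₁) (σ : K →+* ℂ),
      (Model.picardCMUniverse exists_isReal_hodgeModel_holds hodgePQ_independent_of_hodgeModel_holds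
        BallQuotient.ballQuotientUniformised_holds cmAbelianVarietyRealised_holds).PeriodNV ι₁ V K f.psi σ)
    {n : ℕ} (Θ : Fin (n + 1) → CMType K) :
    HodgeConjectureFor (cmProdAV K cmAbelianVarietyRealised_holds n Θ).dim
      (cmProdAV K cmAbelianVarietyRealised_holds n Θ).X :=
  Model.hodgeConjectureFor_cmProdAV_of_weilFaceAlgebraic_of_riemann _ _ _ _ K deligneMilne1982_Thm_6_20_full_holds hG h6
    (fun f => weilFaceAlgebraic_of_exists_foreignFacePeriod f (h f)) Θ

/-- **… and for every complex abelian variety dominated by `∏_j A_{(K,Θ_j)}`**, from the foreign face periods of `K` alone.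
[cite: MumfordAV1970, §19 Thm. 1 and p. 169] [cite: Milne2020HodgeClassesAV, Theorem 1] -/
theorem hodgeConjectureFor_of_avDominatedBy_cmProdAV_of_exists_foreignFacePeriod_at (K : CMField) [hG : IsGalois ℚ K]
    (h6 : 6 ≤ Module.finrank ℚ K)
    (h : ∀ f : Face K, ∃ (L : CMField) (ι₁ : L →+* ℂ) (V : HermSpace3 L ι₁) (σ : K →+* ℂ),
      (Model.picardCMUniverse exists_isReal_hodgeModel_holds hodgePQ_independent_of_hodgeModel_holds
        BallQuotient.ballQuotientUniformised_holds cmAbelianVarietyRealised_holds).PeriodNV ι₁ V K f.psi σ)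
    (A : AbelianVariety ℂ) {n : ℕ} {Θ : Fin (n + 1) → CMType K}
    (hdom : AVDominatedBy A (cmProdAV K cmAbelianVarietyRealised_holds n Θ)) : HodgeConjectureFor A.dim A.X :=
  Model.hodgeConjectureFor_of_avDominatedBy_cmProdAV_of_weilFaceAlgebraic_of_riemann _ _ _ _ K
    deligneMilne1982_Thm_6_20_full_holds hG h6 (fun f => weilFaceAlgebraic_of_exists_foreignFacePeriod f (h f)) A hdom

/-- **INT-2 with foreign surfaces, CLOSED — the `K`-generated CM slice of the Hodge conjecture.**  Let `K` be ONE Galois CM field with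
`6 ≤ [K:ℚ]` such that every rank-four face `f` of `K` has a foreign period witness on the universe of record (SOME CM field `L`, SOME
place `ι₁` of `L`, SOME hermitian 3-space over `(L, ι₁)`, SOME level, eigenforms at SOME `σ : K →+* ℂ`).  Then every complex abelian
variety `A` dominated by a finite product of abelian varieties each realising a CM type of a CM field `E` with `E →+* K` satisfies
`HodgeConjectureFor A.dim A.X`, in every codimension.  NO other hypothesis.  (FRAMING: conditional on `K`'s face periods; `HC_CM` is
not proved.) [cite: Shimura1998, §6.2 Theorem 3 and §6.1 Corollary of Theorem 2 (pp. 41–43)] [cite: Pohlmann1968, Thm. 1]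
[cite: Andre1992HodgeCM, Théorème (pp. 4–5)] [cite: MumfordAV1970, §19 Thm. 1 and p. 169] -/
theorem hodgeConjectureFor_of_avDominatedBy_isProductOf_of_exists_foreignFacePeriod_at (K : CMField) [hG : IsGalois ℚ K]
    (h6 : 6 ≤ Module.finrank ℚ K)
    (h : ∀ f : Face K, ∃ (L : CMField) (ι₁ : L →+* ℂ) (V : HermSpace3 L ι₁) (σ : K →+* ℂ),
      (Model.picardCMUniverse exists_isReal_hodgeModel_holds hodgePQ_independent_of_hodgeModel_holds
        BallQuotient.ballQuotientUniformised_holds cmAbelianVarietyRealised_holds).PeriodNV ι₁ V K f.psi σ)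
    {P A : AbelianVariety ℂ} (hP : AbelianVariety.IsProductOf (fun B : AbelianVariety ℂ =>
      ∃ (E : Type) (_ : Field E) (_ : NumberField E) (_ : IsCMField E) (_ : E →+* (K : Type)) (Φ : CMType E)
        (ι : 𝓞 E →+* End B) (θ : E →+* Module.End ℂ (complexBetti B.X 1)),
        IsCMTypeRealisation Φ B ι θ) P)
    (hA : AVDominatedBy A P) : HodgeConjectureFor A.dim A.X :=
  Model.hodgeConjectureFor_of_avDominatedBy_isProductOf_of_weilFaceAlgebraic_of_riemann _ _ _ _ K
    deligneMilne1982_Thm_6_20_full_holds hG h6 (fun f => weilFaceAlgebraic_of_exists_foreignFacePeriod f (h f)) hP hA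

/-- **Headline `B^{a+1} × E^{b+1}`** with foreign surfaces: `B` realising a CM type of `K`, `E` a CM type of a CM subfield `E₀ →+* K`;
every abelian variety dominated by `B^{a+1} × E^{b+1}` satisfies the Hodge conjecture — from foreign face periods of `K` alone.
[cite: Shimura1998, §6.2 Theorem 3 and §6.1 Corollary of Theorem 2 (pp. 41–43)] [cite: Milne2020HodgeClassesAV, Theorem 1] -/
theorem hodgeConjectureFor_of_avDominatedBy_powSucc_prod_powSucc_of_exists_foreignFacePeriod_at (K : CMField)
    [hG : IsGalois ℚ K] (h6 : 6 ≤ Module.finrank ℚ K)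
    (h : ∀ f : Face K, ∃ (L : CMField) (ι₁ : L →+* ℂ) (V : HermSpace3 L ι₁) (σ : K →+* ℂ),
      (Model.picardCMUniverse exists_isReal_hodgeModel_holds hodgePQ_independent_of_hodgeModel_holds
        BallQuotient.ballQuotientUniformised_holds cmAbelianVarietyRealised_holds).PeriodNV ι₁ V K f.psi σ)
    {Ψ : CMType K} {B : AbelianVariety ℂ} {ιB : 𝓞 K →+* End B}
    {θB : (K : Type) →+* Module.End ℂ (complexBetti B.X 1)} (hB : IsCMTypeRealisation Ψ B ιB θB)
    {E₀ : Type} [Field E₀] [NumberField E₀] [IsCMField E₀] (k : E₀ →+* (K : Type)) {Φ₀ : CMType E₀}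
    {E : AbelianVariety ℂ} {ιE : 𝓞 E₀ →+* End E} {θE : E₀ →+* Module.End ℂ (complexBetti E.X 1)}
    (hE : IsCMTypeRealisation Φ₀ E ιE θE) (a b : ℕ) {A : AbelianVariety ℂ}
    (hA : AVDominatedBy A ((B.powSucc a).prod (E.powSucc b))) : HodgeConjectureFor A.dim A.X :=
  hodgeConjectureFor_of_avDominatedBy_powSucc_prod_powSucc_of_weilFaceAlgebraic K
    BallQuotient.ballQuotientUniformised_holds hG h6
    (fun f => weilFaceAlgebraic_of_exists_foreignFacePeriod f (h f)) hB k hE a b hA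

end Summit.HodgeConjecture.CorCM
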